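import Summits.AnomalousDissipation.AnomalousDissipation.Theorems.ScalarAnomalySteadySourceFormal.Negative.KillShape
import Summits.AnomalousDissipation.AnomalousDissipation.Theorems.ScalarAnomalySteadySourceFormal.Negative.RestFlowSteady
import Literature.Analysis.FluidPDE.PassiveScalarEnergyProofs
import Literature.Analysis.FluidPDE.PassiveScalarSpectralBounds
import Literature.Analysis.FluidPDE.LongTimeAverageNonneg
import Literature.Analysis.FunctionSpaces.TorusSobolevNormFacts

/-!
# Negative knowledge for the crux `ScalarAnomalySteadySourceFormal` (stmt-AnomalousDissipation-0448), IV-b: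
# REFUTED STRENGTHENING — the flow at rest is dead, for every datum and every weak solution

Certified copy of the second half of §6 of the cdisprove work file: honest variance bounds for a
rest-flow witness (`ae_scalarL2Sq_le`, `ae_floor`, `variance_floor`: `‖𝓕θ_p(k)‖²/8 ≤ ⟨‖θ‖²⟩`),
`source_eq_zero` (a `j`-uniform variance bound along `ν_j → 0` forces `h = 0`),
`dissipation_mean_nonpos` (tree energy inequality), and the no-go `restFlow_not_anomalous` /
`not_cruxRestFlow` / `not_anomalous_of_isCandidate_rest`: NO witness of the crux has its flow at rest,
whatever the `L²` data and the weak solutions.  Supports stmt-AnomalousDissipation-0448.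
-/

set_option linter.dupNamespace false

noncomputable section

open scoped BigOperators Topology ENNReal NNReal InnerProductSpace ContDiff
open Filter Set Function MeasureTheory UnitAddTorus Complex

namespace Summit.AnomalousDissipation.AnomalousDissipation.Theorems.ScalarAnomalySteadySourceFormal.Negative

open Literature.Analysis
open Literature.Analysis.FunctionSpaces Literature.Analysis.FunctionSpaces.Torus
open Literature.Analysis.FluidPDE Literature.Analysis.FluidPDE.Torus
open Summit.AnomalousDissipation.AnomalousDissipation.Theses.TwoAndHalfD

variable {d : Type*} [Fintype d]

section VarianceFloor

variable [DecidableEq d] [Nonempty d]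
variable {ν : ℝ} {h θ₀ : UnitAddTorus d → ℝ} {θ : ℝ → UnitAddTorus d → ℝ}

/-- **Honest variance, upper bound**: for a.e. `t ∈ (0,T)`,
`‖θ(t)‖² ≤ 2‖θ₀ - θ_p‖² + 2‖θ_p‖²`, uniformly in `T`. [folklore] -/
theorem ae_scalarL2Sq_le (hν : 0 < ν) (hh : IsSmooth h) (hmean : HasZeroMean h) (hθ₀ : MemLp θ₀ 2 volume)
    (hweak : IsWeakScalarTransportForced ν (fun (_ : ℝ) (_ : UnitAddTorus d) => (0 : EuclideanSpace ℝ d))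
      (fun _ => h) θ₀ θ) {T : ℝ} (hT : 0 < T) :
    ∀ᵐ t ∂(volume.restrict (Ioo 0 T)), scalarL2Sq (θ t) ≤
      2 * (∫⁻ x, ‖θ₀ x - steadyState ν h x‖ₑ ^ 2).toReal + 2 * ∫ x, steadyState ν h x ^ 2 := by
  classical
  have hθp : IsSmooth (steadyState ν h) := isSmooth_steadyState ν hh
  have hB : ∫⁻ x, ‖θ₀ x - steadyState ν h x‖ₑ ^ 2 < ⊤ := by
    have hB' := lintegral_rpow_enorm_lt_top_of_eLpNorm_lt_top two_ne_zero ENNReal.ofNat_ne_top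
      (hθ₀.sub (hθp.memLp 2)).eLpNorm_lt_top
    convert hB' using 1
    refine lintegral_congr fun x => ?_
    rw [ENNReal.toReal_ofNat, ENNReal.rpow_two]
    rfl
  filter_upwards [ae_slice hh hweak hT 0, tilde_ae_lintegral_sq_le hν hh hmean hθ₀ hweak hT]
    with t ⟨ht, ht', _⟩ hlin
  have e1 : ∫ x, (θ t x - steadyState ν h x) ^ 2 ≤ (∫⁻ x, ‖θ₀ x - steadyState ν h x‖ₑ ^ 2).toReal := by
    rw [integral_sq_eq_toReal_lintegral ht']
    exact ENNReal.toReal_mono hB.ne hlin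
  have hpt : ∀ x, θ t x ^ 2 ≤ 2 * (θ t x - steadyState ν h x) ^ 2 + 2 * steadyState ν h x ^ 2 :=
    fun x => by nlinarith [sq_nonneg (θ t x - 2 * steadyState ν h x)]
  have i1 : Integrable (fun x => 2 * (θ t x - steadyState ν h x) ^ 2) volume := ht'.integrable_sq.const_mul 2
  have i2 : Integrable (fun x => 2 * steadyState ν h x ^ 2) volume := ((hθp.memLp 2).integrable_sq).const_mul 2
  calc scalarL2Sq (θ t) = ∫ x, θ t x ^ 2 := rfl
    _ ≤ ∫ x, (2 * (θ t x - steadyState ν h x) ^ 2 + 2 * steadyState ν h x ^ 2) :=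
        integral_mono ht.integrable_sq (i1.add i2) hpt
    _ = (2 * ∫ x, (θ t x - steadyState ν h x) ^ 2) + 2 * ∫ x, steadyState ν h x ^ 2 := by
        rw [integral_add i1 i2, integral_const_mul, integral_const_mul]
    _ ≤ 2 * (∫⁻ x, ‖θ₀ x - steadyState ν h x‖ₑ ^ 2).toReal + 2 * ∫ x, steadyState ν h x ^ 2 := by
        linarith

/-- **Honest variance, lower bound far out in time**: if `‖𝓕(θ₀-θ_p)(k)‖ e^{-4π²ν|k|²t} ≤ ‖𝓕θ_p(k)‖/2`
for `t ≥ t₁`, then `‖θ(t)‖² ≥ ‖𝓕θ_p(k)‖²/4` for a.e. `t ∈ (0,T)` with `t ≥ t₁` (Bessel for the single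
mode `k`, exact decay of the fluctuation mode). [folklore] -/
theorem ae_floor (hν : 0 < ν) (hh : IsSmooth h) (hmean : HasZeroMean h) (hθ₀ : MemLp θ₀ 2 volume)
    (hweak : IsWeakScalarTransportForced ν (fun (_ : ℝ) (_ : UnitAddTorus d) => (0 : EuclideanSpace ℝ d))
      (fun _ => h) θ₀ θ) {T : ℝ} (hT : 0 < T) (k : d → ℤ) {t₁ : ℝ}
    (ht₁ : ∀ t, t₁ ≤ t → ‖mFourierCoeff (fun x => ((θ₀ x - steadyState ν h x : ℝ) : ℂ)) k‖ *
      Real.exp (-(4 * Real.pi ^ 2 * ν * freqNormSq k) * t) ≤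
        ‖mFourierCoeff (fun x => (steadyState ν h x : ℂ)) k‖ / 2) :
    ∀ᵐ t ∂(volume.restrict (Ioo 0 T)), t₁ ≤ t →
      ‖mFourierCoeff (fun x => (steadyState ν h x : ℂ)) k‖ ^ 2 / 4 ≤ scalarL2Sq (θ t) := by
  filter_upwards [ae_slice hh hweak hT k, tilde_mode_eq hν hh hmean hθ₀ hweak hT k]
    with t ⟨ht, _, hsum⟩ hmode htt
  set P := mFourierCoeff (fun x => (steadyState ν h x : ℂ)) k with hP
  set z₀ := mFourierCoeff (fun x => ((θ₀ x - steadyState ν h x : ℝ) : ℂ)) k with hz₀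
  have hB := sq_norm_mFourierCoeff_le_integral_sq ht k
  rw [hsum, hmode] at hB
  -- `‖z(t) + P‖ ≥ ‖P‖ - ‖z(t)‖ ≥ ‖P‖/2`
  have hz : ‖Complex.exp (-(((4 * Real.pi ^ 2 * ν * freqNormSq k : ℝ)) : ℂ) * t) * z₀‖ ≤ ‖P‖ / 2 := by
    rw [norm_mul, norm_cexp_neg_real, mul_comm]
    exact ht₁ t htt
  have htri : ‖P‖ - ‖P‖ / 2 ≤ ‖Complex.exp (-(((4 * Real.pi ^ 2 * ν * freqNormSq k : ℝ)) : ℂ) * t) * z₀ + P‖ := by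
    have := norm_sub_norm_le P (-(Complex.exp (-(((4 * Real.pi ^ 2 * ν * freqNormSq k : ℝ)) : ℂ) * t) * z₀))
    rw [norm_neg, sub_neg_eq_add, add_comm] at this
    linarith
  have hP2 : ‖P‖ / 2 ≤ ‖Complex.exp (-(((4 * Real.pi ^ 2 * ν * freqNormSq k : ℝ)) : ℂ) * t) * z₀ + P‖ := by
    linarith
  have hsq : (‖P‖ / 2) ^ 2 ≤ ‖Complex.exp (-(((4 * Real.pi ^ 2 * ν * freqNormSq k : ℝ)) : ℂ) * t) * z₀ + P‖ ^ 2 :=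
    pow_le_pow_left₀ (by positivity) hP2 2
  calc ‖P‖ ^ 2 / 4 = (‖P‖ / 2) ^ 2 := by ring
    _ ≤ _ := hsq
    _ ≤ ∫ x, θ t x ^ 2 := hB
    _ = scalarL2Sq (θ t) := rfl

end VarianceFloor


section Assembly

variable [DecidableEq d] [Nonempty d]
variable {ν : ℝ} {h θ₀ : UnitAddTorus d → ℝ} {θ : ℝ → UnitAddTorus d → ℝ}

omit [DecidableEq d] [Nonempty d] in
/-- `∫_{(t₁,T)} c = (T - t₁) c` for `t₁ ≤ T`. [folklore] -/
theorem setIntegral_const_Ioo {t₁ T : ℝ} (h : t₁ ≤ T) (c : ℝ) :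
    ∫ _ in Ioo t₁ T, c = (T - t₁) * c := by
  rw [setIntegral_const, smul_eq_mul, Measure.real, Real.volume_Ioo, ENNReal.toReal_ofReal (by linarith)]

/-- **VARIANCE FLOOR.** For a rest-flow solution with smooth mean-zero source, `ν > 0`, `L²` datum
and a mode `k ≠ 0`: `⟨‖θ‖²⟩ ≥ ‖𝓕θ_p(k)‖²/8`, the long-time average being HONEST (Cesàro means
eventually between `‖𝓕θ_p(k)‖²/8` and `2‖θ₀-θ_p‖² + 2‖θ_p‖²`). [folklore] -/
theorem variance_floor (hν : 0 < ν) (hh : IsSmooth h) (hmean : HasZeroMean h) (hθ₀ : MemLp θ₀ 2 volume)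
    (hweak : IsWeakScalarTransportForced ν (fun (_ : ℝ) (_ : UnitAddTorus d) => (0 : EuclideanSpace ℝ d))
      (fun _ => h) θ₀ θ) {k : d → ℤ} (hk : k ≠ 0) :
    ‖mFourierCoeff (fun x => (steadyState ν h x : ℂ)) k‖ ^ 2 / 8 ≤ longTimeAvgSup (fun t => scalarL2Sq (θ t)) := by
  set P := mFourierCoeff (fun x => (steadyState ν h x : ℂ)) k with hP
  set z₀ := mFourierCoeff (fun x => ((θ₀ x - steadyState ν h x : ℝ) : ℂ)) k with hz₀
  set a : ℝ := 4 * Real.pi ^ 2 * ν * freqNormSq k with ha_def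
  set M : ℝ := 2 * (∫⁻ x, ‖θ₀ x - steadyState ν h x‖ₑ ^ 2).toReal + 2 * ∫ x, steadyState ν h x ^ 2 with hM
  set g : ℝ → ℝ := fun t => scalarL2Sq (θ t) with hg
  have hg0 : ∀ t, 0 ≤ g t := fun t => scalarL2Sq_nonneg _
  rcases (norm_nonneg P).eq_or_lt with hp0 | hp
  · rw [← hp0]
    simpa using longTimeAvgSup_nonneg hg0
  -- decay time `t₁ ≥ 0`: `‖z₀‖ e^{-at} ≤ ‖P‖/2` for `t ≥ t₁`
  have ha : 0 < a := by
    rw [ha_def]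
    have := lt_of_lt_of_le one_pos (FunctionSpaces.Torus.one_le_freqNormSq_of_ne_zero hk)
    positivity
  have hev : ∀ᶠ t : ℝ in atTop, ‖z₀‖ * Real.exp (-a * t) ≤ ‖P‖ / 2 := by
    have h1 : Tendsto (fun t : ℝ => a * t) atTop atTop := tendsto_id.const_mul_atTop ha
    have h2 : Tendsto (fun t : ℝ => Real.exp (-(a * t))) atTop (nhds 0) :=
      Real.tendsto_exp_neg_atTop_nhds_zero.comp h1
    have h3 : Tendsto (fun t : ℝ => ‖z₀‖ * Real.exp (-a * t)) atTop (nhds (‖z₀‖ * 0)) := by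
      refine (h2.const_mul ‖z₀‖).congr fun t => ?_
      rw [neg_mul]
    rw [mul_zero] at h3
    exact (h3.eventually (Iio_mem_nhds (by positivity : (0 : ℝ) < ‖P‖ / 2))).mono fun t ht => ht.le
  obtain ⟨t₀, ht₀⟩ := eventually_atTop.1 hev
  set t₁ : ℝ := max t₀ 0 with ht₁_def
  have ht₁0 : 0 ≤ t₁ := le_max_right _ _
  have ht₁ : ∀ t, t₁ ≤ t → ‖z₀‖ * Real.exp (-(4 * Real.pi ^ 2 * ν * freqNormSq k) * t) ≤ ‖P‖ / 2 :=
    fun t ht => ht₀ t ((le_max_left _ _).trans ht)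
  -- for every horizon: integrability, lower and upper bounds of the Cesàro mean
  have hmean_bounds : ∀ T, 2 * t₁ ≤ T → 1 ≤ T → ‖P‖ ^ 2 / 8 ≤ timeMean g T ∧ timeMean g T ≤ M := by
    intro T hT2 hT1
    have hT : 0 < T := by linarith
    have hmeas := aestronglyMeasurable_scalarL2Sq (hweak T hT)
    have hbound := ae_scalarL2Sq_le hν hh hmean hθ₀ hweak hT
    have hint : IntegrableOn g (Ioo 0 T) volume := by
      refine IntegrableOn.of_bound measure_Ioo_lt_top hmeas M ?_
      filter_upwards [hbound] with t ht
      rw [Real.norm_eq_abs, abs_of_nonneg (hg0 t)]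
      exact ht
    have htm : timeMean g T = T⁻¹ * ∫ t in Ioo 0 T, g t := by
      rw [timeMean, intervalIntegral.integral_of_le hT.le, integral_Ioc_eq_integral_Ioo]
    constructor
    · -- lower bound
      have hfloor := ae_floor hν hh hmean hθ₀ hweak hT k ht₁
      have hsub : Ioo t₁ T ⊆ Ioo 0 T := Ioo_subset_Ioo_left ht₁0
      have h1 : ∫ t in Ioo t₁ T, (‖P‖ ^ 2 / 4 : ℝ) ≤ ∫ t in Ioo t₁ T, g t := by
        refine integral_mono_ae (integrableOn_const (hs := measure_Ioo_lt_top.ne)) (hint.mono_set hsub) ?_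
        have hfl' := ae_restrict_of_ae_restrict_of_subset hsub hfloor
        filter_upwards [hfl', ae_restrict_mem measurableSet_Ioo] with t ht htI
        exact ht htI.1.le
      have h2 : ∫ t in Ioo t₁ T, g t ≤ ∫ t in Ioo 0 T, g t :=
        setIntegral_mono_set hint (Eventually.of_forall fun t => hg0 t) (Eventually.of_forall hsub)
      rw [setIntegral_const_Ioo (by linarith) (‖P‖ ^ 2 / 4)] at h1
      rw [htm]
      have hTi : 0 < T⁻¹ := inv_pos.2 hT
      have key : T / 2 * (‖P‖ ^ 2 / 4) ≤ ∫ t in Ioo 0 T, g t := by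
        have : T / 2 ≤ T - t₁ := by linarith
        nlinarith [sq_nonneg ‖P‖]
      calc ‖P‖ ^ 2 / 8 = T⁻¹ * (T / 2 * (‖P‖ ^ 2 / 4)) := by field_simp; ring
        _ ≤ T⁻¹ * ∫ t in Ioo 0 T, g t := mul_le_mul_of_nonneg_left key hTi.le
    · -- upper bound
      have h1 : ∫ t in Ioo 0 T, g t ≤ ∫ t in Ioo 0 T, (M : ℝ) :=
        integral_mono_ae hint (integrableOn_const (hs := measure_Ioo_lt_top.ne)) hbound
      rw [setIntegral_const_Ioo hT.le, sub_zero] at h1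
      rw [htm]
      calc T⁻¹ * ∫ t in Ioo 0 T, g t ≤ T⁻¹ * (T * M) := mul_le_mul_of_nonneg_left h1 (inv_pos.2 hT).le
        _ = M := by field_simp
  -- pass to the `limsup`
  have hfreq : ∃ᶠ T in atTop, ‖P‖ ^ 2 / 8 ≤ timeMean g T := by
    refine Eventually.frequently ?_
    filter_upwards [eventually_ge_atTop (2 * t₁), eventually_ge_atTop (1 : ℝ)] with T h1 h2
    exact (hmean_bounds T h1 h2).1
  have hbdd : IsBoundedUnder (· ≤ ·) atTop (timeMean g) := by
    refine ⟨M, ?_⟩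
    rw [eventually_map]
    filter_upwards [eventually_ge_atTop (2 * t₁), eventually_ge_atTop (1 : ℝ)] with T h1 h2
    exact (hmean_bounds T h1 h2).2
  exact le_limsup_of_frequently_le hfreq hbdd

/-- **THE SOURCE MUST VANISH.** Along any family of rest-flow solutions with `ν_j → 0`, `L²` data and
ONE smooth mean-zero source `h`, a `j`-uniform bound on the mean variances forces `h = 0`:
mode by mode, `‖𝓕h(k)‖² ≤ 8E (4π²|k|²)² ν_j² → 0`. [folklore] -/
theorem source_eq_zero (hh : IsSmooth h) (hmean : HasZeroMean h) {νs : ℕ → ℝ} (hν : ∀ j, 0 < νs j)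
    (hν0 : Tendsto νs atTop (nhds 0)) {θ₀s : ℕ → UnitAddTorus d → ℝ} (hθ₀ : ∀ j, MemLp (θ₀s j) 2 volume)
    {θs : ℕ → ℝ → UnitAddTorus d → ℝ}
    (hweak : ∀ j, IsWeakScalarTransportForced (νs j) (fun (_ : ℝ) (_ : UnitAddTorus d) => (0 : EuclideanSpace ℝ d))
      (fun _ => h) (θ₀s j) (θs j))
    {E : ℝ} (hV : ∀ j, longTimeAvgSup (fun t => scalarL2Sq (θs j t)) ≤ E) : h = 0 := by
  -- all Fourier coefficients of `h` vanish
  have hcoef : ∀ k : d → ℤ, mFourierCoeff (fun x => (h x : ℂ)) k = 0 := by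
    intro k
    by_cases hk : k = 0
    · subst hk
      rw [FunctionSpaces.Torus.mFourierCoeff_eq_integral_conj_mul]
      simp only [mFourier_zero, ContinuousMap.one_apply, map_one, one_mul]
      rw [integral_complex_ofReal, hmean, Complex.ofReal_zero]
    · by_contra hc
      set c := mFourierCoeff (fun x => (h x : ℂ)) k with hc_def
      set C : ℝ := 4 * Real.pi ^ 2 * freqNormSq k with hC_def
      have hCpos : 0 < C := by
        rw [hC_def]
        have := lt_of_lt_of_le one_pos (FunctionSpaces.Torus.one_le_freqNormSq_of_ne_zero hk)
        positivity
      have hcpos : 0 < ‖c‖ := norm_pos_iff.2 hc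
      -- for every `j`: `‖c‖² ≤ 8 E C² ν_j²`
      have hj : ∀ j, ‖c‖ ^ 2 ≤ 8 * E * C ^ 2 * νs j ^ 2 := by
        intro j
        have hfl := variance_floor (hν j) hh hmean (hθ₀ j) (hweak j) hk
        rw [mFourierCoeff_steadyState (hν j).ne' hh hmean hk] at hfl
        have hnorm : ‖c / ((νs j : ℂ) * (C : ℂ))‖ = ‖c‖ / (νs j * C) := by
          rw [norm_div, norm_mul, Complex.norm_real, Complex.norm_real, Real.norm_of_nonneg (hν j).le,
            Real.norm_of_nonneg hCpos.le]
        rw [← hC_def, hnorm] at hfl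
        have hfl' : (‖c‖ / (νs j * C)) ^ 2 / 8 ≤ E := hfl.trans (hV j)
        have hden : 0 < νs j * C := mul_pos (hν j) hCpos
        rw [div_pow, div_div, div_le_iff₀ (by positivity)] at hfl'
        nlinarith [hfl']
      have hlim : Tendsto (fun j => 8 * E * C ^ 2 * νs j ^ 2) atTop (nhds (8 * E * C ^ 2 * 0 ^ 2)) :=
        (hν0.pow 2).const_mul _
      rw [zero_pow two_ne_zero, mul_zero] at hlim
      have : ‖c‖ ^ 2 ≤ 0 := ge_of_tendsto' hlim hj
      nlinarith
  -- hence `h = 0`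
  have hC : (fun x => (h x : ℂ)) = fun _ => (0 : ℂ) :=
    FunctionSpaces.Torus.eq_of_forall_mFourierCoeff_eq (Complex.continuous_ofReal.comp hh.continuous)
      continuous_const fun k => by rw [hcoef k, mFourierCoeff_zero_fun]
  funext x
  have := congrFun hC x
  simpa using this

omit [DecidableEq d] [Nonempty d] in
/-- **NO DISSIPATION WITHOUT A SOURCE.** A rest-flow weak solution with zero source, `ν > 0` and `L²`
datum has `⟨ν‖∇θ‖²⟩ ≤ 0` (energy inequality of the homogeneous heat equation, in tree:
`∫₀ᵀ ν‖∇θ‖² ≤ ‖θ₀‖²/2` for every `T`). [folklore] -/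
theorem dissipation_mean_nonpos (hν : 0 < ν) (hθ₀ : MemLp θ₀ 2 volume)
    (hweak : IsWeakScalarTransportForced ν (fun (_ : ℝ) (_ : UnitAddTorus d) => (0 : EuclideanSpace ℝ d))
      (fun (_ : ℝ) => (0 : UnitAddTorus d → ℝ)) θ₀ θ) :
    longTimeAvgSup (fun t => ν * (eScalarGradNormSq (θ t)).toReal) ≤ 0 := by
  set G : ℝ → ℝ≥0∞ := fun t => eScalarGradNormSq (θ t) with hG
  set gd : ℝ → ℝ := fun t => ν * (G t).toReal with hgd
  have hgd0 : ∀ t, 0 ≤ gd t := fun t => mul_nonneg hν.le ENNReal.toReal_nonneg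
  set B₀ : ℝ≥0∞ := ∫⁻ x, ‖θ₀ x‖ₑ ^ 2 with hB₀
  have hB₀ : B₀ < ⊤ := by
    have hB' := lintegral_rpow_enorm_lt_top_of_eLpNorm_lt_top two_ne_zero ENNReal.ofNat_ne_top hθ₀.eLpNorm_lt_top
    convert hB' using 1
    refine lintegral_congr fun x => ?_
    rw [ENNReal.toReal_ofNat, ENNReal.rpow_two]
  have hu : ∀ T : ℝ, MemLp (FunctionSpaces.Torus.stLift fun (_ : ℝ) (_ : UnitAddTorus d) => (0 : EuclideanSpace ℝ d)) ∞
      (volume.restrict (Ioo 0 T ×ˢ univ)) := fun T => memLp_top_const _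
  -- Cesàro means: `timeMean gd T ≤ B₀/T`
  have hmean_le : ∀ T, 0 < T → timeMean gd T ≤ T⁻¹ * B₀.toReal := by
    intro T hT
    have hW : IsWeakScalarTransportOn T ν (fun (_ : ℝ) (_ : UnitAddTorus d) => (0 : EuclideanSpace ℝ d)) θ₀ θ :=
      isWeakScalarTransportForcedOn_zero_iff.1 (hweak T hT)
    have hE := IsWeakScalarTransportOn.energy_ineq_holds hν hW hθ₀ (hu T)
    -- `ofReal ν * L ≤ B₀`
    have hL : ENNReal.ofReal ν * ∫⁻ t in Ioo 0 T, G t ≤ B₀ := by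
      have : eScalarDissipation ν θ 0 T ≤ 2 * eScalarDissipation ν θ 0 T := by
        rw [two_mul]; exact le_self_add
      exact this.trans hE
    have hLfin : ∫⁻ t in Ioo 0 T, G t < ⊤ :=
      ENNReal.lt_top_of_mul_ne_top_right (ne_top_of_le_ne_top hB₀.ne hL) (by simp [hν])
    have hGm : AEMeasurable G (volume.restrict (Ioo 0 T)) := hW.aemeasurable_eScalarGradNormSq
    have hint : ∫ t in Ioo 0 T, (G t).toReal = (∫⁻ t in Ioo 0 T, G t).toReal :=
      integral_toReal hGm (ae_lt_top' hGm hLfin.ne)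
    have htm : timeMean gd T = T⁻¹ * (ν * (∫⁻ t in Ioo 0 T, G t).toReal) := by
      rw [timeMean, intervalIntegral.integral_of_le hT.le, integral_Ioc_eq_integral_Ioo]
      simp only [hgd]
      rw [integral_const_mul, hint]
    rw [htm]
    refine mul_le_mul_of_nonneg_left ?_ (inv_pos.2 hT).le
    have := ENNReal.toReal_mono hB₀.ne hL
    rwa [ENNReal.toReal_mul, ENNReal.toReal_ofReal hν.le] at this
  -- `limsup ≤ δ` for every `δ > 0`
  refine le_of_forall_pos_le_add fun δ hδ => ?_
  rw [zero_add]
  have hcb : IsCoboundedUnder (· ≤ ·) atTop (timeMean gd) :=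
    isCoboundedUnder_le_of_eventually_le atTop
      ((eventually_ge_atTop (0 : ℝ)).mono fun T hT => timeMean_nonneg hgd0 hT)
  refine limsup_le_of_le hcb ?_
  filter_upwards [eventually_gt_atTop (0 : ℝ), eventually_ge_atTop (B₀.toReal / δ)] with T hT hTB
  refine (hmean_le T hT).trans ?_
  rw [inv_mul_le_iff₀ hT]
  rw [div_le_iff₀ hδ] at hTB
  linarith

/-- **REST-FLOW NO-GO (refuted strengthening of the crux).** No family of weak solutions of the
sourced heat equation — the crux's scalar clause with the flow AT REST — with `ν_j → 0`, `L²` data,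
one smooth mean-zero source and `j`-uniformly bounded mean variance can have a `j`-uniform
positive floor under its mean dissipation: the variance bound forces `h = 0`, and then every mean
dissipation vanishes. [folklore] -/
theorem restFlow_not_anomalous (hh : IsSmooth h) (hmean : HasZeroMean h) {νs : ℕ → ℝ}
    (hν : ∀ j, 0 < νs j) (hν0 : Tendsto νs atTop (nhds 0)) {θ₀s : ℕ → UnitAddTorus d → ℝ}
    (hθ₀ : ∀ j, MemLp (θ₀s j) 2 volume) {θs : ℕ → ℝ → UnitAddTorus d → ℝ}
    (hweak : ∀ j, IsWeakScalarTransportForced (νs j) (fun (_ : ℝ) (_ : UnitAddTorus d) => (0 : EuclideanSpace ℝ d))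
      (fun _ => h) (θ₀s j) (θs j))
    (hV : ∃ E : ℝ, ∀ j, longTimeAvgSup (fun t => scalarL2Sq (θs j t)) ≤ E) :
    ¬ ∃ ε : ℝ, 0 < ε ∧ ∀ j, ε ≤ longTimeAvgSup (fun t => νs j * (eScalarGradNormSq (θs j t)).toReal) := by
  obtain ⟨E, hE⟩ := hV
  have h0 : h = 0 := source_eq_zero hh hmean hν hν0 hθ₀ hweak hE
  subst h0
  rintro ⟨ε, hε, hfl⟩
  have h1 := hfl 0
  have h2 := dissipation_mean_nonpos (hν 0) (hθ₀ 0) (hweak 0)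
  linarith

end Assembly


/-- **REFUTED STRENGTHENING: no witness of the crux has its flow at rest** (`v_j ≡ 0`; the
Leray–Hopf and energy clauses are then automatic for `g = 0` and dropped here, which only
strengthens the negation). [folklore] -/
theorem not_cruxRestFlow :
    ¬ ∃ (g : (UnitAddTorus (Fin 2)) → (EuclideanSpace ℝ (Fin 2))) (h : (UnitAddTorus (Fin 2)) → ℝ), IsAdmissible g h ∧
      ∃ (ν : ℕ → ℝ) (θ₀ : ℕ → (UnitAddTorus (Fin 2)) → ℝ) (θ : ℕ → ℝ → (UnitAddTorus (Fin 2)) → ℝ), (∀ j, 0 < ν j) ∧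
        Tendsto ν atTop (nhds 0) ∧ (∀ j, MemLp (θ₀ j) 2 volume) ∧
        (∀ j, IsWeakScalarTransportForced (ν j) (fun (_ : ℝ) (_ : (UnitAddTorus (Fin 2))) => (0 : (EuclideanSpace ℝ (Fin 2))))
          (fun _ => h) (θ₀ j) (θ j)) ∧
        VarianceBounded θ ∧ Anomalous ν θ := by
  rintro ⟨g, h, hadm, ν, θ₀, θ, hν, hν0, hθ₀, hweak, hV, hA⟩
  exact restFlow_not_anomalous hadm.smooth_h hadm.zeroMean_h hν hν0 hθ₀ hweak hV hA

/-- The same through the clause bundle of §1: a candidate family with `v = 0` and bounded variance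
is never anomalous. [folklore] -/
theorem not_anomalous_of_isCandidate_rest {g : (UnitAddTorus (Fin 2)) → (EuclideanSpace ℝ (Fin 2))} {h : (UnitAddTorus (Fin 2)) → ℝ} (hadm : IsAdmissible g h)
    {ν : ℕ → ℝ} {v₀ : ℕ → (UnitAddTorus (Fin 2)) → (EuclideanSpace ℝ (Fin 2))} {θ₀ : ℕ → (UnitAddTorus (Fin 2)) → ℝ} {θ : ℕ → ℝ → (UnitAddTorus (Fin 2)) → ℝ}
    (hc : IsCandidate g h ν v₀ (fun _ _ _ => 0) θ₀ θ) (hV : VarianceBounded θ) : ¬ Anomalous ν θ :=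
  restFlow_not_anomalous hadm.smooth_h hadm.zeroMean_h hc.pos hc.tendsto hc.memLp hc.weak hV

/-- … and its source must vanish: at rest, clause (v) alone forces `h = 0`. [folklore] -/
theorem source_eq_zero_of_isCandidate_rest {g : (UnitAddTorus (Fin 2)) → (EuclideanSpace ℝ (Fin 2))} {h : (UnitAddTorus (Fin 2)) → ℝ} (hadm : IsAdmissible g h)
    {ν : ℕ → ℝ} {v₀ : ℕ → (UnitAddTorus (Fin 2)) → (EuclideanSpace ℝ (Fin 2))} {θ₀ : ℕ → (UnitAddTorus (Fin 2)) → ℝ} {θ : ℕ → ℝ → (UnitAddTorus (Fin 2)) → ℝ}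
    (hc : IsCandidate g h ν v₀ (fun _ _ _ => 0) θ₀ θ) (hV : VarianceBounded θ) : h = 0 := by
  obtain ⟨E, hE⟩ := hV
  exact source_eq_zero hadm.smooth_h hadm.zeroMean_h hc.pos hc.tendsto hc.memLp hc.weak hE


end Summit.AnomalousDissipation.AnomalousDissipation.Theorems.ScalarAnomalySteadySourceFormal.Negative
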